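import Literature.AlgebraicGeometry.Frobenioids.ArchimedeanFrobenioidRelative
import Literature.AlgebraicGeometry.Frobenioids.ArchimedeanCoAngular
import HarnessLib

/-!
# Frobenioids II, Thm. 3.6 (i) at `Λ = ℚ`, piece P2 (i): DISCS over an object of `C = C₀ ×_{D₀} D` and the
# scalar arrows out of them (the co-angular pre-steps on which the standard germs of `O^×((A, n)^birat)` live)

Mochizuki, *The geometry of Frobenioids II: poly-Frobenioids*, Kyushu J. Math. **62** (2008) 401–460, §3,
Ex. 3.3 (i) pp. 27–28 (objects `(Spec K, V_K, A_K)` and morphisms `(Base(φ), deg_Fr(φ), V_L^{⊗d} ⥲ V_K|_L)` of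
`C₀`; "`Div(φ) := log(λ)`"), Ex. 3.3 (ii) p. 28 ("co-angular if and only if naively co-angular"), Thm. 3.6 (i)
p. 36 [cite: MochizukiFrdII2008, Ex 3.3 (i) p.27].

abc-iut cell, layer L1, row M13-c3 piece **P2** (L1-lead R113/R114; DESIGN HOME/staging/L1/L1-t6/g3/M13-c3-DESIGN.md;
seat abc-iut-w5-d246), file 1 of the P2 chain (file 2: `ArchimedeanPerfectionBiratSection.lean`).  For an object
`B` of `C` (abc-iut-L1-t6's `ArchFrd.C π = PreFrobenioid.FiberProduct C0.toElem π`):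
* `disc B t` — the object with the base (`Spec K`, `D`-object, identification) of `B` and THE DISC of radius `t`
  as angular region (naively isotropic);
* `discIncl B hB t z` — for `B` naively isotropic, the arrow `disc B t → B` with `Base = id`, `deg_Fr = 1` and a
  prescribed scalar `z ∈ K^×` with `|z|·t ≤ tip(B)`; composites multiply scalars (`discIncl_comp_discIncl`);
  it is a **co-angular pre-step** of `C` (`isCoAngularPreStep_discIncl`, via abc-iut-L1's
  `Ex33ii_coAngular_iff_holds`), with `Div = log(tip(B)/(|z|·t))` (`ratio_discIncl`);
* `rad B z`, `rad₂ B z z'` — canonical radii `tip/(1+|z|)`, `tip/((1+|z|)(1+|z'|))` with their inequalities.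
Data-level `def`s (objects/arrows/radii); no `def … : Prop`; nothing here bears on [IUTchIII] Cor. 3.12.
-/

noncomputable section

namespace Literature.AlgebraicGeometry.Frobenioids

open CategoryTheory Opposite
open scoped Pointwise NNReal

universe v u

namespace ArchFrd

namespace Thm36Sub

variable {D : Type u} [Category.{v} D] {π : D ⥤ D0}

/-! ### Discs over an object of `C` and the scalar arrows out of them -/

/-- `disc B t`: the object of `C = C₀ ×_{D₀} D` with the same base (`Spec K`, `D`-object and identification)
as `B` and angular region THE DISC of radius `t` (naively isotropic). [cite: MochizukiFrdII2008, Ex 3.3 (i) p.27] -/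
@[reducible] def disc (B : C π) (t : PosReal) : C π :=
  ⟨⟨B.fst.base, AngularRegion.isotropicOfTip t, fun _ => AngularRegion.isIsotropic_isotropicOfTip t⟩, B.snd,
    B.iso⟩

/-- `disc B t` is naively isotropic. [cite: MochizukiFrdII2008, Ex 3.3 (i) p.27] -/
theorem isNaivelyIsotropic_disc (B : C π) (t : PosReal) : (disc B t).fst.IsNaivelyIsotropic :=
  AngularRegion.isIsotropic_isotropicOfTip t

/-- The tip of `disc B t` is `t`. [cite: MochizukiFrdII2008, Ex 3.3 (i) p.27] -/
@[simp] theorem tip_disc (B : C π) (t : PosReal) : (disc B t).fst.tip = t := rfl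

/-- The `D`-object of `disc B t` is that of `B`. [cite: MochizukiFrdII2008, Ex 3.3 (i) p.27] -/
@[simp] theorem disc_snd (B : C π) (t : PosReal) : (disc B t).snd = B.snd := rfl

/-- The base of `disc B t` is that of `B`. [cite: MochizukiFrdII2008, Ex 3.3 (i) p.27] -/
@[simp] theorem disc_fst_base (B : C π) (t : PosReal) : (disc B t).fst.base = B.fst.base := rfl

/-- A disc inside a disc is a disc over the same object (definitionally). [cite: MochizukiFrdII2008, Ex 3.3 (i) p.27] -/
theorem disc_disc (B : C π) (t t' : PosReal) : disc (disc B t') t = disc B t := rfl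

/-- **The scalar arrow `disc B t → B`** with `Base = id`, `deg_Fr = 1` and scalar `z ∈ K^×`, for `B`
naively isotropic and `|z| · t ≤ tip(B)` (Ex. 3.3 (i): "an isomorphism `V_L ⥲ V_K|_L` that maps `A_L`
into `A_K|_L`" — multiplication by `z`). [cite: MochizukiFrdII2008, Ex 3.3 (i) p.27] -/
def discIncl (B : C π) (hB : B.fst.IsNaivelyIsotropic) (t : PosReal) (z : ℂˣ)
    (hz : z ∈ D0.scalars B.fst.base) (h : ‖(z : ℂ)‖ * t ≤ B.fst.tip) : disc B t ⟶ B where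
  fst :=
    { base := 𝟙 _
      degFr := 1
      scalar := z
      scalar_mem := hz
      mapsTo := by
        rw [PNat.one_coe, pow_one]
        change z • (AngularRegion.isotropicOfTip (K := ℂ) t).carrier ⊆ C0.pullRegion B.fst (𝟙 B.fst.base)
        rw [C0.pullRegion_id]
        rintro _ ⟨u, hu, rfl⟩
        rw [C0.mem_carrier_of_isIsotropic hB, ← Subtype.coe_le_coe, coe_absHom]
        rw [C0.mem_carrier_of_isIsotropic (AngularRegion.isIsotropic_isotropicOfTip t), ← Subtype.coe_le_coe,
          coe_absHom] at hu
        change ‖((z * u : ℂˣ) : ℂ)‖ ≤ B.fst.tip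
        rw [Units.val_mul, norm_mul]
        exact (mul_le_mul_of_nonneg_left hu (norm_nonneg _)).trans h }
  snd := 𝟙 _
  w := by
    simp only [CategoryTheory.Functor.map_id, Category.comp_id]
    exact Category.id_comp _

section DiscIncl

variable {B : C π} {hB : B.fst.IsNaivelyIsotropic} {t : PosReal} {z : ℂˣ} {hz : z ∈ D0.scalars B.fst.base}
  {h : ‖(z : ℂ)‖ * t ≤ B.fst.tip}

/-- `Base` of the scalar arrow (in `D₀`) is the identity. [cite: MochizukiFrdII2008, Ex 3.3 (i) p.27] -/
@[simp] theorem base_discIncl : C0.Base (discIncl B hB t z hz h).fst = 𝟙 _ := rfl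

/-- `deg_Fr` of the scalar arrow is `1`. [cite: MochizukiFrdII2008, Ex 3.3 (i) p.27] -/
@[simp] theorem degFr_discIncl : C0.degFr (discIncl B hB t z hz h).fst = 1 := rfl

/-- The scalar of the scalar arrow. [cite: MochizukiFrdII2008, Ex 3.3 (i) p.27] -/
@[simp] theorem scalar_discIncl : C0.scalar (discIncl B hB t z hz h).fst = z := rfl

/-- The `D`-component of the scalar arrow is the identity. [cite: MochizukiFrdII2008, Ex 3.3 (i) p.27] -/
@[simp] theorem discIncl_snd : (discIncl B hB t z hz h).snd = 𝟙 _ := rfl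

end DiscIncl

/-- Two scalar arrows `disc B t → B` with the same scalar are equal (an arrow of `C₀` is determined by
`(Base, deg_Fr, scalar)`). [cite: MochizukiFrdII2008, Ex 3.3 (i) p.27] -/
theorem discIncl_congr {B : C π} {hB hB' : B.fst.IsNaivelyIsotropic} {t : PosReal} {z z' : ℂˣ}
    {hz : z ∈ D0.scalars B.fst.base} {hz' : z' ∈ D0.scalars B.fst.base} {h : ‖(z : ℂ)‖ * t ≤ B.fst.tip}
    {h' : ‖(z' : ℂ)‖ * t ≤ B.fst.tip} (e : z = z') : discIncl B hB t z hz h = discIncl B hB' t z' hz' h' := by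
  subst e; rfl

/-- **Composition of scalar arrows multiplies the scalars**: `disc B s → disc B t → B` with scalars `w`,
`z` is the scalar arrow with scalar `z · w` (the Galois twist of the identity base is trivial).
[cite: MochizukiFrdII2008, Ex 3.3 (i) p.27] -/
theorem discIncl_comp_discIncl {B : C π} (hB : B.fst.IsNaivelyIsotropic) {s t : PosReal} {w z : ℂˣ}
    (hw : w ∈ D0.scalars B.fst.base) (hz : z ∈ D0.scalars B.fst.base) (hs : ‖(w : ℂ)‖ * s ≤ t)
    (ht : ‖(z : ℂ)‖ * t ≤ B.fst.tip) (hst : ‖((z * w : ℂˣ) : ℂ)‖ * s ≤ B.fst.tip) :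
    discIncl (disc B t) (isNaivelyIsotropic_disc B t) s w hw hs ≫ discIncl B hB t z hz ht =
      discIncl B hB s (z * w) (mul_mem hz hw) hst := by
  refine CFP.hom_ext (C0.hom_ext ?_ ?_ ?_) ?_
  · change C0.Base (C0.Hom.comp _ _) = _
    exact Category.id_comp _
  · rfl
  · change (𝟙 B.fst.base : B.fst.base ⟶ B.fst.base).act z * w ^ ((1 : ℕ+) : ℕ) = z * w
    rw [PNat.one_coe, pow_one, D0.Hom.act, D0.twists_id, D0.galAct_false]
  · change 𝟙 _ ≫ 𝟙 _ = 𝟙 _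
    exact Category.id_comp _

/-! ### The scalar arrows are co-angular pre-steps of `C` -/

section CoAngular

variable {B : C π}

/-- The scalar arrow `disc B t → B` is naively co-angular: source and target have full angular part
(Ex. 3.3 (i) p. 28: co-angular = same projections to `O_L^× = S¹`). [cite: MochizukiFrdII2008, Ex 3.3 (i) p.28] -/
theorem isNaivelyCoAngular_discIncl (hB : B.fst.IsNaivelyIsotropic) (t : PosReal) (z : ℂˣ)
    (hz : z ∈ D0.scalars B.fst.base) (h : ‖(z : ℂ)‖ * t ≤ B.fst.tip) :
    C0.IsNaivelyCoAngular (discIncl B hB t z hz h).fst := by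
  intro _
  rw [C0.image_unitPart_homImage, C0.image_unitPart_pullRegion]
  change unitPart ℂ z • (Set.univ : Set (normOneSubgroup ℂ)) ^ ((1 : ℕ+) : ℕ) =
    (fun w : normOneSubgroup ℂ => unitPart ℂ ((𝟙 B.fst.base : B.fst.base ⟶ B.fst.base).act (w : ℂˣ))) ''
      B.fst.region.dir
  rw [show B.fst.region.dir = Set.univ from hB, PNat.one_coe, pow_one, Set.smul_set_univ, Set.image_univ]
  exact (Function.Surjective.range_eq fun (w : normOneSubgroup ℂ) =>
    ⟨unitPart ℂ ((𝟙 B.fst.base : B.fst.base ⟶ B.fst.base).act (w : ℂˣ)), C0.twist_twist _ w⟩).symm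

/-- **The scalar arrow `disc B t → B` is a co-angular pre-step of `C`** (`deg_Fr = 1`, `Base = id`, and
co-angular ⟸ naively co-angular by Ex. 3.3 (ii), abc-iut's `Ex33ii_coAngular_iff_holds`).
[cite: MochizukiFrdII2008, Ex 3.3 (ii) p.28] -/
theorem isCoAngularPreStep_discIncl (hB : B.fst.IsNaivelyIsotropic) (t : PosReal) (z : ℂˣ)
    (hz : z ∈ D0.scalars B.fst.base) (h : ‖(z : ℂ)‖ * t ≤ B.fst.tip) :
    PreFrobenioid.IsCoAngularPreStep (C.toElem π) (discIncl B hB t z hz h) :=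
  ⟨(Ex33ii_coAngular_iff_holds π (discIncl B hB t z hz h)).mpr (isNaivelyCoAngular_discIncl hB t z hz h),
    show PreFrobenioid.degFr (C.toElem π) (discIncl B hB t z hz h) = 1 from rfl,
    show IsIso (discIncl B hB t z hz h).snd from by change IsIso (𝟙 B.snd); infer_instance⟩

/-- `Base` (in `D`) of the scalar arrow is the identity. [cite: MochizukiFrdII2008, Ex 3.3 (i) p.27] -/
theorem base_toElem_discIncl (hB : B.fst.IsNaivelyIsotropic) (t : PosReal) (z : ℂˣ)
    (hz : z ∈ D0.scalars B.fst.base) (h : ‖(z : ℂ)‖ * t ≤ B.fst.tip) :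
    PreFrobenioid.Base (C.toElem π) (discIncl B hB t z hz h) = 𝟙 B.snd := rfl

/-- `Div` of the scalar arrow is `log(tip(B) / (|z|·t))` (Ex. 3.3 (i) p. 28: "`Div(φ) := log(λ)` for the largest
`λ` with `λ · Im(A_L) ⊆ A_K|_L`"). [cite: MochizukiFrdII2008, Ex 3.3 (i) p.28] -/
theorem div_toElem_discIncl (hB : B.fst.IsNaivelyIsotropic) (t : PosReal) (z : ℂˣ)
    (hz : z ∈ D0.scalars B.fst.base) (h : ‖(z : ℂ)‖ * t ≤ B.fst.tip) :
    PreFrobenioid.Div (C.toElem π) (discIncl B hB t z hz h) = C0.div (discIncl B hB t z hz h).fst := rfl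

/-- The ratio `tip(B) / (|z| · t)` of the scalar arrow. [cite: MochizukiFrdII2008, Ex 3.3 (i) p.28] -/
theorem ratio_discIncl (hB : B.fst.IsNaivelyIsotropic) (t : PosReal) (z : ℂˣ)
    (hz : z ∈ D0.scalars B.fst.base) (h : ‖(z : ℂ)‖ * t ≤ B.fst.tip) :
    C0.ratio (discIncl B hB t z hz h).fst = B.fst.tip / (‖(z : ℂ)‖ * t) := by
  change B.fst.tip / (‖(z : ℂ)‖ * (t : ℝ) ^ ((1 : ℕ+) : ℕ)) = _
  rw [PNat.one_coe, pow_one]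

/-- `Div` of a scalar arrow of `C`, as a real number, is `log(tip(B) / (|z| · t))`. [cite: MochizukiFrdII2008, Ex 3.3 (i) p.28] -/
theorem toAdd_div_discIncl (hB : B.fst.IsNaivelyIsotropic) (t : PosReal) (z : ℂˣ)
    (hz : z ∈ D0.scalars B.fst.base) (h : ‖(z : ℂ)‖ * t ≤ B.fst.tip) :
    ((Multiplicative.toAdd (PreFrobenioid.Div (C.toElem π) (discIncl B hB t z hz h)) : ℝ≥0) : ℝ) =
      Real.log (B.fst.tip / (‖(z : ℂ)‖ * t)) := by
  rw [div_toElem_discIncl, C0.coe_toAdd_div, ratio_discIncl]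

end CoAngular

/-! ### The canonical radii -/

section Radii

variable (B : C π)

/-- The canonical radius `tip(A^{(c)}) / (1 + |z|)` for the standard fraction of scalar `z` (any radius `t` with
`t ≤ tip`, `|z|·t ≤ tip` gives the same class, `mk_stdFrac_eq_mk_stdFrac`). [cite: MochizukiFrdII2008, Ex 3.3 (i) p.27] -/
def rad (z : ℂˣ) : PosReal :=
  ⟨B.fst.tip / (1 + ‖(z : ℂ)‖), div_pos (C0.tip_pos _) (by positivity)⟩

/-- `rad z ≤ tip`. [cite: MochizukiFrdII2008, Ex 3.3 (i) p.27] -/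
theorem rad_le (z : ℂˣ) : ((rad B z : PosReal) : ℝ) ≤ B.fst.tip :=
  div_le_self (C0.tip_pos _).le (le_add_of_nonneg_right (norm_nonneg _))

/-- `|z| · rad z ≤ tip`. [cite: MochizukiFrdII2008, Ex 3.3 (i) p.27] -/
theorem norm_mul_rad_le (z : ℂˣ) : ‖(z : ℂ)‖ * (rad B z : ℝ) ≤ B.fst.tip := by
  change ‖(z : ℂ)‖ * (B.fst.tip / (1 + ‖(z : ℂ)‖)) ≤ _
  rw [mul_div_assoc', div_le_iff₀ (by positivity)]
  nlinarith [C0.tip_pos B.fst, norm_nonneg (z : ℂ)]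

/-- The radius of the common refinement used for products: `tip / ((1 + |z|)(1 + |z'|))`.
[cite: MochizukiFrdI2008, Prop. 4.4 (i) p.84] -/
def rad₂ (z z' : ℂˣ) : PosReal :=
  ⟨B.fst.tip / ((1 + ‖(z : ℂ)‖) * (1 + ‖(z' : ℂ)‖)), div_pos (C0.tip_pos _) (by positivity)⟩

/-- `rad₂ z z' ≤ rad z'`. [cite: MochizukiFrdI2008, Prop. 4.4 (i) p.84] -/
theorem rad₂_le_rad (z z' : ℂˣ) : ((rad₂ B z z' : PosReal) : ℝ) ≤ (rad B z' : ℝ) := by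
  change B.fst.tip / ((1 + ‖(z : ℂ)‖) * (1 + ‖(z' : ℂ)‖)) ≤
    B.fst.tip / (1 + ‖(z' : ℂ)‖)
  rw [div_le_div_iff₀ (by positivity) (by positivity)]
  have h0 := C0.tip_pos B.fst
  nlinarith [mul_nonneg h0.le (norm_nonneg (z : ℂ)), mul_nonneg (mul_nonneg h0.le (norm_nonneg (z : ℂ)))
    (norm_nonneg (z' : ℂ))]

/-- `|z'| · rad₂ z z' ≤ rad z`. [cite: MochizukiFrdI2008, Prop. 4.4 (i) p.84] -/
theorem norm_mul_rad₂_le_rad (z z' : ℂˣ) : ‖(z' : ℂ)‖ * (rad₂ B z z' : ℝ) ≤ (rad B z : ℝ) := by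
  change ‖(z' : ℂ)‖ * (B.fst.tip / ((1 + ‖(z : ℂ)‖) * (1 + ‖(z' : ℂ)‖))) ≤
    B.fst.tip / (1 + ‖(z : ℂ)‖)
  rw [mul_div_assoc', div_le_div_iff₀ (by positivity) (by positivity)]
  nlinarith [C0.tip_pos B.fst, norm_nonneg (z : ℂ), norm_nonneg (z' : ℂ),
    mul_nonneg (norm_nonneg (z : ℂ)) (norm_nonneg (z' : ℂ))]

/-- `rad₂ z z' ≤ tip`. [cite: MochizukiFrdI2008, Prop. 4.4 (i) p.84] -/
theorem rad₂_le (z z' : ℂˣ) : ((rad₂ B z z' : PosReal) : ℝ) ≤ B.fst.tip :=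
  (rad₂_le_rad B z z').trans (rad_le B z')

/-- `|z z'| · rad₂ z z' ≤ tip`. [cite: MochizukiFrdI2008, Prop. 4.4 (i) p.84] -/
theorem norm_mul_rad₂_le (z z' : ℂˣ) :
    ‖((z * z' : ℂˣ) : ℂ)‖ * (rad₂ B z z' : ℝ) ≤ B.fst.tip := by
  rw [Units.val_mul, norm_mul, mul_assoc]
  exact (mul_le_mul_of_nonneg_left (norm_mul_rad₂_le_rad B z z') (norm_nonneg _)).trans
    (norm_mul_rad_le B z)

end Radii

end Thm36Sub

end ArchFrd

end Literature.AlgebraicGeometry.Frobenioids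

end
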